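/- Width seat `ym-line-cbag-p1-w3` (prover-ym-line-cbag-p1-w3-g5-0) of the sibling line `ColdBoxAllGroups` (planner-of-record ym-idea-2):
the ASSEMBLY item of route `AllWindowsColdBox` (stmt-QuantumFields-23033) — the route's own deciding theorem, by name. -/
import Summits.QuantumFields.YangMills.Theses.AllWindowsColdBox

/-!
# Route `AllWindowsColdBox`, item `Assembly` (stmt-QuantumFields-23033): `BoxAllWindowsSU22 → BulkWindowSU2 → XiSuperPolySU2`

The assembly item of the route is the implication from its two cruxes to its target, and the route file's planner-authored deciding
theorem `Theses.AllWindowsColdBox.closes` (glue_v3: `A ↦` window `(2A, θ)` with `2A < θ ≤ 14A`, `massGapPowerDecayOf_of_box`, FLOOR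
`curvatureCorrPowerFloor_proof`, `ε = 2A/2 = A`) proves exactly it; this file records the item BY NAME so the ledger can close it
(as `ColdBoxAllGroups.assembly_proof` did for the sibling route).  It says nothing about the cruxes themselves (`BoxAllWindowsSU22`
stmt-QuantumFields-22910 and `BulkWindowSU2` stmt-QuantumFields-23030 are OPEN beyond the one-scale windows settled in
`Theorems/AllWindowsColdBoxBoxAllWindowsSU22SmallWindows.lean` / `Theorems/AllWindowsColdBoxBulkWindowSU2SmallWindows.lean`).
No sorry; standard axioms.  NOT the Yang–Mills mass gap: an implication between rung-level statements (proposed RECORD-label rung R2ξ″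
`XiSuperPolySU2`); no summit statement is proved.
-/

set_option autoImplicit false

namespace Summit.QuantumFields.YangMills.Theorems.AllWindowsColdBox

/-- **Item `Assembly` of route `AllWindowsColdBox`** (stmt-QuantumFields-23033): `BoxAllWindowsSU22 → BulkWindowSU2 → XiSuperPolySU2`,
i.e. BOX at every collar window and BULK at some collar window for every `A` give `ξ(β) ≥ β^A` for every `A` (4-D `SU(2)`) — the route's
deciding theorem `closes`.  An implication only; NOT the Clay gap, and neither hypothesis is proved here. -/
theorem assembly_proof : Summit.QuantumFields.YangMills.Theses.AllWindowsColdBox.Assembly :=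
  fun h₁ h₂ => Summit.QuantumFields.YangMills.Theses.AllWindowsColdBox.closes h₁ h₂

end Summit.QuantumFields.YangMills.Theorems.AllWindowsColdBox
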